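import Summits.Ventures.CertifiedManyBodySolver.Certificates.HubbardSquare_afChord_CCOCNickelatesHg
import Summits.Ventures.CertifiedManyBodySolver.Certificates.HubbardSquare_affwords_polrow_CCOC
import Summits.Ventures.CertifiedManyBodySolver.Downfold.BoxesCCOC
import Summits.Ventures.CertifiedManyBodySolver.Downfold.BoxesCCOCM57
import Summits.Ventures.CertifiedManyBodySolver.Downfold.BoxesHg1201E
import Summits.Ventures.CertifiedManyBodySolver.Downfold.ThermalAnnexSeam
import HarnessLib

/-!
# HYPOTHESIS-FREE TYPED T-AXIS WORDS ON THE CCOC AND Hg-1201 BOXES: every CLOSED `T = 0` cell word (box-p2's sandwich ⋈ AF-chord words `sw_afc_*`, box-eng-1's polrow words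
# `aw_pr_*`) through the THERMAL ANNEX SEAM (`ThermalAnnexSeam.holdsOn_thermalAnnex_of_cellWord` = box-p2's `thermalWindow_of_constWord_Icc₃_decimal` on a typed box)

Venture CertifiedManyBodySolver, cell `pub/hubbard-downfold` (stage S1 ↔ S2 seam, D-0099 T axis), seat hubbard-downfold-mod-1; namespace
`Summit.Ventures.CertifiedManyBodySolver.Downfold`. For each box below the `T = 0` word `[F, C]` is unconditional, hence so is the T-axis word: for every temperature
cell `Θ = [kT₁, kT₂]` (eV, `0 < kT₁`), every `kT ∈ Θ`, member `p`, `β' ≥ p t_eV/kT`, every torus-limit canonical-SECTOR Gibbs state of the member's unit `t–t′` model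
`H(1, p tp/t, p U/t)` at `β'`, filling `p n`: **`e(ω) ∈ [F, C + 1.3863·kT₂/t₁]`** (`t₁` = the box's lower `t_eV` end; slack = `log 4 · kT₂/t₁`). Table (F, C, t₁; caps at
`T ≤ 300 K` (`kT₂ = 13/500`) and `T ≤ 100 K` (`87/10000`), 10-dp outward):
* `boxCCOCE_M36` (Na-CCOC x = 0.10 (#36)): [-1.6181341102, -0.4311790114], t₁ = 0.39 ⇒ 300 K cap -0.3387590114, 100 K cap -0.4002538575
* `boxCCOCE_M58` (CCOC parent (M58)): [-1.7104192665, -0.1939380652], t₁ = 0.39 ⇒ 300 K cap -0.1015180652, 100 K cap -0.1630129113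
* `boxCCOCE_M57` (Na-CCOC x = 0.20 (M57, polrow)): [-1.5203235434, -0.6342744819], t₁ = 0.39 ⇒ 300 K cap -0.5418544819, 100 K cap -0.6033493280
* `boxHg1201E_M19` (Hg-1201 p 0.16 (#19)): [-1.6528397902, -0.6160608881], t₁ = 0.5 ⇒ 300 K cap -0.5439732881, 100 K cap -0.5919392681
* `boxHg1201E_M19b` (Hg-1201 p 0.125 (M19b)): [-1.6957011184, -0.5611756159], t₁ = 0.5 ⇒ 300 K cap -0.4890880159, 100 K cap -0.5370539959
These are WEAKER than the cold-ray words where those exist (cell #1: −0.5596 at 300 K vs −0.4685 here) but hold on EVERY listed box with NO hypothesis — the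
universal T-axis fallback for the D-0099 maps. HONEST FRAMING: energy windows for torus limits of canonical-sector Gibbs states (density-keyed), in units of
the member's `t`; object-E `t–t′` readings (boxes are S1's screening-grade typed boxes — the attachment to a material is as good as the box); nothing here is a
phase sentence, an order word or a `T_c`. Everything is PROVED; no definition, no `sorry`.
-/

noncomputable section

namespace Summit.Ventures.CertifiedManyBodySolver.Downfold

open NonemptyInterval Literature.MathematicalPhysics.QuantumLattice
  Literature.MathematicalPhysics.QuantumLattice.ThermodynamicLimit
  Literature.MathematicalPhysics.QuantumLattice.InfVolFermionState
  Literature.Probability.LatticeModels _root_.Filter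
  Summit.Ventures.CertifiedManyBodySolver.Certificates

open scoped ComplexOrder

/-- **HYPOTHESIS-FREE typed T-axis word on `boxCCOCE_M36`** (Na-CCOC x = 0.10 (#36); `t₁ = 39/100` eV): for every temperature cell `Θ = [kT₁, kT₂]` (eV, `0 < kT₁`),
every `kT ∈ Θ`, member `p`, `β' ≥ p t_eV/kT` and every torus-limit sector-Gibbs state of `H(1, p tp/t, p U/t)` at `β'`, filling `p n`:
**`e(ω) ∈ [-1.6181341102, -0.4311790114 + 1.3863/((39/100)/kT₂)]`** — the CLOSED `T = 0` word `sw_afc_ccocE_M36_word` through `holdsOn_thermalAnnex_of_cellWord`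
(e.g. `T ≤ 300 K`: cap -0.3387590114; `T ≤ 100 K`: -0.4002538575). No hypothesis of any kind. [cite: Israel1979, Thm. I.3.4] [cite: Ruelle1969, §2.5–2.6] -/
theorem boxCCOCE_M36_thermalAnnex_closed {Θ : NonemptyInterval ℚ} (hΘ : 0 < Θ.fst) {kT : ℝ} (hk : kT ∈ Θ.ratCast ℝ) :
    HoldsOn (fun p : OneBandCoord → ℝ => ∀ β' : ℝ, p .tEV / kT ≤ β' →
      ∀ (ω : InfVolFermionState 2) (Ls : ℕ → ℕ), Tendsto Ls atTop atTop →
        ω.IsTorusLimitOfMixture (sectorGibbsCount (p .filling))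
          (fun L => sectorGibbsWeightTT' β' 1 (p .tpOverT) (p .UOverT) (p .filling) L)
          (fun L => sectorGibbsVectorTT' 1 (p .tpOverT) (p .UOverT) (p .filling) L) Ls →
        ω.meanEnergy (hubbardTTPrimeFermionInteraction 1 (p .tpOverT) (p .UOverT)) 1 ∈
          Set.Icc (-1.6181341102 : ℝ) ((-0.4311790114 : ℝ) + 1.3863 / ((((39/100 : ℚ) / Θ.snd : ℚ)) : ℝ))) boxCCOCE_M36 :=
  holdsOn_thermalAnnex_of_cellWord (B := boxCCOCE_M36) (eU := cCOCE_M36_U) (eS := cCOCE_M36_tp) (eN := cCOCE_M36_n) (eT := cCOCE_M36_t) rfl rfl rfl rfl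
    (by rw [cCOCE_M36_U, Entry.encl_ofEnds_fst]; norm_num) (by rw [cCOCE_M36_n, Entry.encl_ofEnds_fst]; norm_num)
    (by rw [cCOCE_M36_n, Entry.encl_ofEnds_snd]; norm_num) (by rw [cCOCE_M36_t, Entry.encl_ofEnds_fst]) (by norm_num)
    (by rw [cCOCE_M36_s2Lo, cCOCE_M36_s2Hi]; exact sw_afc_ccocE_M36_word) hΘ hk

/-- **HYPOTHESIS-FREE typed T-axis word on `boxCCOCE_M58`** (CCOC parent (M58); `t₁ = 39/100` eV): for every temperature cell `Θ = [kT₁, kT₂]` (eV, `0 < kT₁`),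
every `kT ∈ Θ`, member `p`, `β' ≥ p t_eV/kT` and every torus-limit sector-Gibbs state of `H(1, p tp/t, p U/t)` at `β'`, filling `p n`:
**`e(ω) ∈ [-1.7104192665, -0.1939380652 + 1.3863/((39/100)/kT₂)]`** — the CLOSED `T = 0` word `sw_afc_ccocE_M58_word` through `holdsOn_thermalAnnex_of_cellWord`
(e.g. `T ≤ 300 K`: cap -0.1015180652; `T ≤ 100 K`: -0.1630129113). No hypothesis of any kind. [cite: Israel1979, Thm. I.3.4] [cite: Ruelle1969, §2.5–2.6] -/
theorem boxCCOCE_M58_thermalAnnex_closed {Θ : NonemptyInterval ℚ} (hΘ : 0 < Θ.fst) {kT : ℝ} (hk : kT ∈ Θ.ratCast ℝ) :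
    HoldsOn (fun p : OneBandCoord → ℝ => ∀ β' : ℝ, p .tEV / kT ≤ β' →
      ∀ (ω : InfVolFermionState 2) (Ls : ℕ → ℕ), Tendsto Ls atTop atTop →
        ω.IsTorusLimitOfMixture (sectorGibbsCount (p .filling))
          (fun L => sectorGibbsWeightTT' β' 1 (p .tpOverT) (p .UOverT) (p .filling) L)
          (fun L => sectorGibbsVectorTT' 1 (p .tpOverT) (p .UOverT) (p .filling) L) Ls →
        ω.meanEnergy (hubbardTTPrimeFermionInteraction 1 (p .tpOverT) (p .UOverT)) 1 ∈
          Set.Icc (-1.7104192665 : ℝ) ((-0.1939380652 : ℝ) + 1.3863 / ((((39/100 : ℚ) / Θ.snd : ℚ)) : ℝ))) boxCCOCE_M58 :=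
  holdsOn_thermalAnnex_of_cellWord (B := boxCCOCE_M58) (eU := cCOCE_M58_U) (eS := cCOCE_M58_tp) (eN := cCOCE_M58_n) (eT := cCOCE_M58_t) rfl rfl rfl rfl
    (by rw [cCOCE_M58_U, Entry.encl_ofEnds_fst]; norm_num) (by rw [cCOCE_M58_n, Entry.encl_ofEnds_fst]; norm_num)
    (by rw [cCOCE_M58_n, Entry.encl_ofEnds_snd]; norm_num) (by rw [cCOCE_M58_t, Entry.encl_ofEnds_fst]) (by norm_num)
    (by rw [cCOCE_M58_s2Lo, cCOCE_M58_s2Hi]; exact sw_afc_ccocE_M58_word) hΘ hk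

/-- **HYPOTHESIS-FREE typed T-axis word on `boxCCOCE_M57`** (Na-CCOC x = 0.20 (M57, polrow); `t₁ = 39/100` eV): for every temperature cell `Θ = [kT₁, kT₂]` (eV, `0 < kT₁`),
every `kT ∈ Θ`, member `p`, `β' ≥ p t_eV/kT` and every torus-limit sector-Gibbs state of `H(1, p tp/t, p U/t)` at `β'`, filling `p n`:
**`e(ω) ∈ [-1.5203235434, -0.6342744819 + 1.3863/((39/100)/kT₂)]`** — the CLOSED `T = 0` word `aw_pr_ccocE_M57_word` through `holdsOn_thermalAnnex_of_cellWord`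
(e.g. `T ≤ 300 K`: cap -0.5418544819; `T ≤ 100 K`: -0.6033493280). No hypothesis of any kind. [cite: Israel1979, Thm. I.3.4] [cite: Ruelle1969, §2.5–2.6] -/
theorem boxCCOCE_M57_thermalAnnex_closed {Θ : NonemptyInterval ℚ} (hΘ : 0 < Θ.fst) {kT : ℝ} (hk : kT ∈ Θ.ratCast ℝ) :
    HoldsOn (fun p : OneBandCoord → ℝ => ∀ β' : ℝ, p .tEV / kT ≤ β' →
      ∀ (ω : InfVolFermionState 2) (Ls : ℕ → ℕ), Tendsto Ls atTop atTop →
        ω.IsTorusLimitOfMixture (sectorGibbsCount (p .filling))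
          (fun L => sectorGibbsWeightTT' β' 1 (p .tpOverT) (p .UOverT) (p .filling) L)
          (fun L => sectorGibbsVectorTT' 1 (p .tpOverT) (p .UOverT) (p .filling) L) Ls →
        ω.meanEnergy (hubbardTTPrimeFermionInteraction 1 (p .tpOverT) (p .UOverT)) 1 ∈
          Set.Icc (-1.5203235434 : ℝ) ((-0.6342744819 : ℝ) + 1.3863 / ((((39/100 : ℚ) / Θ.snd : ℚ)) : ℝ))) boxCCOCE_M57 :=
  holdsOn_thermalAnnex_of_cellWord (B := boxCCOCE_M57) (eU := cCOCE_M57_U) (eS := cCOCE_M57_tp) (eN := cCOCE_M57_n) (eT := cCOCE_M57_t) rfl rfl rfl rfl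
    (by rw [cCOCE_M57_U, Entry.encl_ofEnds_fst]; norm_num) (by rw [cCOCE_M57_n, Entry.encl_ofEnds_fst]; norm_num)
    (by rw [cCOCE_M57_n, Entry.encl_ofEnds_snd]; norm_num) (by rw [cCOCE_M57_t, Entry.encl_ofEnds_fst]) (by norm_num)
    (by rw [cCOCE_M57_s2Lo, cCOCE_M57_s2Hi]; exact aw_pr_ccocE_M57_word) hΘ hk

/-- **HYPOTHESIS-FREE typed T-axis word on `boxHg1201E_M19`** (Hg-1201 p 0.16 (#19); `t₁ = 1/2` eV): for every temperature cell `Θ = [kT₁, kT₂]` (eV, `0 < kT₁`),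
every `kT ∈ Θ`, member `p`, `β' ≥ p t_eV/kT` and every torus-limit sector-Gibbs state of `H(1, p tp/t, p U/t)` at `β'`, filling `p n`:
**`e(ω) ∈ [-1.6528397902, -0.6160608881 + 1.3863/((1/2)/kT₂)]`** — the CLOSED `T = 0` word `sw_afc_hg1201E_M19_word` through `holdsOn_thermalAnnex_of_cellWord`
(e.g. `T ≤ 300 K`: cap -0.5439732881; `T ≤ 100 K`: -0.5919392681). No hypothesis of any kind. [cite: Israel1979, Thm. I.3.4] [cite: Ruelle1969, §2.5–2.6] -/
theorem boxHg1201E_M19_thermalAnnex_closed {Θ : NonemptyInterval ℚ} (hΘ : 0 < Θ.fst) {kT : ℝ} (hk : kT ∈ Θ.ratCast ℝ) :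
    HoldsOn (fun p : OneBandCoord → ℝ => ∀ β' : ℝ, p .tEV / kT ≤ β' →
      ∀ (ω : InfVolFermionState 2) (Ls : ℕ → ℕ), Tendsto Ls atTop atTop →
        ω.IsTorusLimitOfMixture (sectorGibbsCount (p .filling))
          (fun L => sectorGibbsWeightTT' β' 1 (p .tpOverT) (p .UOverT) (p .filling) L)
          (fun L => sectorGibbsVectorTT' 1 (p .tpOverT) (p .UOverT) (p .filling) L) Ls →
        ω.meanEnergy (hubbardTTPrimeFermionInteraction 1 (p .tpOverT) (p .UOverT)) 1 ∈
          Set.Icc (-1.6528397902 : ℝ) ((-0.6160608881 : ℝ) + 1.3863 / ((((1/2 : ℚ) / Θ.snd : ℚ)) : ℝ))) boxHg1201E_M19 :=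
  holdsOn_thermalAnnex_of_cellWord (B := boxHg1201E_M19) (eU := hg1201E_M19_U) (eS := hg1201E_M19_tp) (eN := hg1201E_M19_n) (eT := hg1201E_M19_t) rfl rfl rfl rfl
    (by rw [hg1201E_M19_U, Entry.encl_ofEnds_fst]; norm_num) (by rw [hg1201E_M19_n, Entry.encl_ofEnds_fst]; norm_num)
    (by rw [hg1201E_M19_n, Entry.encl_ofEnds_snd]; norm_num) (by rw [hg1201E_M19_t, Entry.encl_ofEnds_fst]) (by norm_num)
    (by rw [hg1201E_M19_s2Lo, hg1201E_M19_s2Hi]; exact sw_afc_hg1201E_M19_word) hΘ hk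

/-- **HYPOTHESIS-FREE typed T-axis word on `boxHg1201E_M19b`** (Hg-1201 p 0.125 (M19b); `t₁ = 1/2` eV): for every temperature cell `Θ = [kT₁, kT₂]` (eV, `0 < kT₁`),
every `kT ∈ Θ`, member `p`, `β' ≥ p t_eV/kT` and every torus-limit sector-Gibbs state of `H(1, p tp/t, p U/t)` at `β'`, filling `p n`:
**`e(ω) ∈ [-1.6957011184, -0.5611756159 + 1.3863/((1/2)/kT₂)]`** — the CLOSED `T = 0` word `sw_afc_hg1201E_M19b_word` through `holdsOn_thermalAnnex_of_cellWord`
(e.g. `T ≤ 300 K`: cap -0.4890880159; `T ≤ 100 K`: -0.5370539959). No hypothesis of any kind. [cite: Israel1979, Thm. I.3.4] [cite: Ruelle1969, §2.5–2.6] -/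
theorem boxHg1201E_M19b_thermalAnnex_closed {Θ : NonemptyInterval ℚ} (hΘ : 0 < Θ.fst) {kT : ℝ} (hk : kT ∈ Θ.ratCast ℝ) :
    HoldsOn (fun p : OneBandCoord → ℝ => ∀ β' : ℝ, p .tEV / kT ≤ β' →
      ∀ (ω : InfVolFermionState 2) (Ls : ℕ → ℕ), Tendsto Ls atTop atTop →
        ω.IsTorusLimitOfMixture (sectorGibbsCount (p .filling))
          (fun L => sectorGibbsWeightTT' β' 1 (p .tpOverT) (p .UOverT) (p .filling) L)
          (fun L => sectorGibbsVectorTT' 1 (p .tpOverT) (p .UOverT) (p .filling) L) Ls →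
        ω.meanEnergy (hubbardTTPrimeFermionInteraction 1 (p .tpOverT) (p .UOverT)) 1 ∈
          Set.Icc (-1.6957011184 : ℝ) ((-0.5611756159 : ℝ) + 1.3863 / ((((1/2 : ℚ) / Θ.snd : ℚ)) : ℝ))) boxHg1201E_M19b :=
  holdsOn_thermalAnnex_of_cellWord (B := boxHg1201E_M19b) (eU := hg1201E_M19b_U) (eS := hg1201E_M19b_tp) (eN := hg1201E_M19b_n) (eT := hg1201E_M19b_t) rfl rfl rfl rfl
    (by rw [hg1201E_M19b_U, Entry.encl_ofEnds_fst]; norm_num) (by rw [hg1201E_M19b_n, Entry.encl_ofEnds_fst]; norm_num)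
    (by rw [hg1201E_M19b_n, Entry.encl_ofEnds_snd]; norm_num) (by rw [hg1201E_M19b_t, Entry.encl_ofEnds_fst]) (by norm_num)
    (by rw [hg1201E_M19b_s2Lo, hg1201E_M19b_s2Hi]; exact sw_afc_hg1201E_M19b_word) hΘ hk

end Summit.Ventures.CertifiedManyBodySolver.Downfold

end
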